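import Summits.RiemannHypothesis.RiemannHypothesis.Theorems.LiTailMidpointZeroTailUniform
import Summits.RiemannHypothesis.RiemannHypothesis.Theorems.LiTailMidpointBridgeUniform
import Summits.RiemannHypothesis.RiemannHypothesis.Theorems.LiTailMidpointFresnelLawReal
import HarnessLib

/-!
# RiemannHypothesis / LI column — vocabulary PART N and the rung leaves «UNIFORM TAIL–FRESNEL LAW» (RH-FREE, every cut)

Cell `pub/rh-li` (D-0040/D-0059/D-0061), theory round 9 (gen 11; dossier `theory/route/r9/`), successor of PART K
(`Theorems/LiTailLaguerreDefs.lean`, leaf `LiZeroTailLaguerre`: ONE cut `c√n` per `n`, OFF the resonances; route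
`Theses/LiTailLaguerre.lean` CLOSED·proved) and PART M (`Theorems/LiTailMidpointDefs.lean`, leaf `LiZeroTailMidpoint`: the cut AT a
resonance `c_m√n`; route `Theses/LiTailMidpoint.lean` CLOSED·proved).  Statement module (`def`s + `@[conjecture]` targets + the two
`_holds`, one-line citations of theorems already in tree; no `sorry`, no axioms).  Round 9 asks for EVERY cut in a window
between two resonances, i.e. through the whole Fresnel transition of the resonant prime power — the statement that makes tapered
(smooth-window) functionals accessible by superposition of cuts.

THE LAWS.  Fix `m ≥ 2` and scales `0 < c₁ ≤ c₂` with `c_{m+1} < c₁`, `c₂ < c_{m−1}` (`c_k = (log k)^{−1/2} = liResonantScale k`;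
equivalently `1/c₁² < log(m+1)`, `log(m−1) < 1/c₂²`), so that `m` is the only possibly-resonant prime power of the window.

* Leaf `LiZeroTailUniform` (BRIDGE FORM): there are `N`, `C` with, for all `n ≥ N` and EVERY cut `T ∈ [c₁√n, c₂√n]`,
  `|liZeroTail n T − liSmoothTail n T + Σ_{2 ≤ k < m} liCoffeyTerm k n + (Λ(m)/π) m^{−1/2} liBridgeTail n (log m) T| ≤ C log² n`:
  the zeros above the cut, minus their Riemann–von Mangoldt mean, equal MINUS the Laguerre terms of the prime powers below `m`
  MINUS `m`'s PARTIAL LAGUERRE BRIDGE above the cut (`liBridgeTail`, PART M), uniformly in the cut.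
* Leaf `LiZeroTailFresnel` (PROFILE FORM; additionally `c₂ < 2c_m`, automatic for `m ≥ 3`): the same with the partial bridge
  replaced by its uniform stationary-phase evaluation `−liFresnelProfile n (log m) T =
  −Re{ e^{iF(t₀)} F''(t₀)^{−1/2} [fresnelLim − σ(T)·fresnelS(√(2(F(T) − F(t₀))))] }` (`F = Fejer.phF n (log m)`, `t₀ = Fejer.tz n (log m)
  = √(n/log m − ¼)`, `σ(T) = ±1` for `T ≷ t₀`, `fresnelS X = ∫_0^X e^{iu²/2} du`, `fresnelLim = √π (1+i)/2`): FULL release of `m`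
  for `T ≪ t₀` (bracket `→ 2·fresnelLim`, the Fejér chirp `−liPrimeEcho m n ≈ liCoffeyTerm m n`), HALF at `T = t₀` (`fresnelS 0 = 0`;
  the midpoint law of PART M), SILENCE for `T ≫ t₀` (bracket `→ 0`), the Fresnel oscillations in between — eng-6 g4's uniform
  variable `X = sgn(T − t₀)·√((2/π)(F(T) − F(t₀)))`.
* Family target `LiBridgeFresnelUniform` (pure analysis, the round-9 core): `|liBridgeTail n y T + liFresnelProfile n y T| ≤ C_y log n`
  for `n ≥ N_y`, `T ∈ [t₀/2, 2t₀]` — PROVED in tree as `BridgeUniform.liBridgeTail_uniform` (eng-4 g6, `Theorems/LiTailMidpointBridgeUniform.lean`).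

STATUS AT TYPING (2026-08-27T01:40Z).  The bridge form is PROVED in tree — `ZeroTailUniform.liZeroTail_uniform`
(`Theorems/LiTailMidpointZeroTailUniform.lean`, rh-li-prover g7, on `PrimeTailUniform.liPrimeTail_uniform`) is statement-identical with
`LiZeroTailUniform` (`liZeroTailUniform_holds` below) — and so is the core, `BridgeUniform.liBridgeTail_uniform` (rh-li-eng-4 g6;
`liBridgeFresnelUniform_holds` below), and their composition `FresnelLaw.liZeroTail_fresnel` / `liZeroTail_fresnel_real`
(rh-li-prover g7, `Theorems/LiTailMidpointFresnelLaw(Real).lean`) closes the profile forms (`liZeroTailFresnel_holds`,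
`liZeroTailFresnelReal_holds` below).  NO ROUTE is needed for round 9: every leaf of this PART is closed by a theorem in tree — the rung
is booked «typed + proved» on this file's acceptance (as PART G's `LiEchoSieve` was).

RH-FREE FOR ALL `n` (rule 4 label): exactly as PART K/M — `liZeroTail n T` subtracts a FINITE box sum from `keiperLiCoeff n`; every
zero above the cut is summed WHATEVER ITS REAL PART (Bombieri–Lagarias, `keiperLiCoeff_eq_zero_sum_holds`); the truth value of the
leaves does not depend on RH and nothing here bears on the truth of RH; PROOF-OF-DATA, NOT height-buying.  (The leaves are stated
`∃ N, ∀ n ≥ N` — the honest asymptotic form of a statement uniform in a `T`-interval; absorbing `n < N` into `C` is cosmetic.)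

DATA (all certified inputs; statistics descriptive; nothing here is evidence for RH) — rh-li-eng-6 g4, round-7/8 exhibits on the
DEPOSITED certified `D_tail(n;c) = liZeroTail − liSmoothTail` rows (221 log-spaced `n ∈ [10³, 10⁷]`, balls of radius `≤ 5.5e-10`):
(3) `step0/reports/STEP0-REPORT-r7-uniform-fresnel-law.md` (kit j259565/j259630, 44 cutoffs `c ∈ [0.66, 1.30]`; j259690, 12 FRESH
cutoffs PRE-REGISTERED): residual of the uniform-variable Fresnel model `R_U := D_tail − Σ_{m ≤ 31} P_m(n;c)` has rms `0.71–0.96` at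
ALL 56 cutoffs, band-6.5 rms `≤ 1.45`, growth exponents `≤ +0.075`, `sup ≤ 3.82` — **12/12 PASS** on the fresh cutoffs (rms
`0.711–0.916`, growth `≤ +0.063`) — while the step convention (weights `1/½/0`) of the proved leaves leaves rms up to `2.9` and growth
up to `+0.196` near resonances: the Fresnel profile removes the `c`-dependence and the pre-asymptotic growth entirely.  (4) `STEP0-REPORT-
r7-boundary-term.md` (+ `-ADDENDUM-certified.md`; kit j259868): adding the Backlund BOUNDARY TERM, `R_B := D_tail + (2 − 2cos nθ(T))·S̃(T)
− Σ_m P_m`, `S̃ = N − N_sm`, gives rms `0.16–0.30` at 56/56 cutoffs (median `0.854 → 0.217`), `sup |R_B| = 1.03` over 12 376 rows, the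
opposite sign doubling the residual.  READING FOR THE TYPED PRECISION: the boundary term is the identified SHAPE of the sub-`log² n`
residual (the sawtooth of single zeros crossing the cut: `liZeroTail` jumps by `2(1 − cos nθ(γ))` at `T = γ`, and `(2 − 2cos nθ(T))S(T)`
jumps by the same amount), NOT a typed term: at every provable sup-norm precision (`C log n` or `C log² n`) it is absorbed by
`|S(T)| ≤ 0.3 log T` (Backlund/Trudgian, tree: `abs_zetaArgS_le_explicit`); it is load-bearing only in MEAN SQUARE over the window,
where the separating theorem would be Selberg's unconditional `∫_T^{2T} S² = (T/2π²) log log T (1 + o(1))` — outside this column.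

MECHANISM (all in tree or in flight; theory adds no proof): the round-7/8 half-strip bookkeeping is ALREADY uniform on `[c√n, n]` —
contour identity at a good height `T' ∈ [T, T+1]` (`liTailContour_proof`), horizontal edge `O(log² n)` (`liTailHorizontal_proof`), polar
`O(log n)` (`liPolarTailBound`), gamma shift `O(log n)` (`liGammaTailShift_proof`), prime tail `= Σ_{k<m} liCoffeyTerm k n +
(Λ(m)/π) m^{−1/2} liBridgeTail n (log m) T' + O(log n)` uniformly (`PrimeTailUniform.liPrimeTail_uniform`: released `k < m` shifted to the
critical line WHOLE, non-released on `Re w = 3/2` by the first-derivative test, the resonant `m` kept as its explicit partial bridge),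
the move `T → T'` costing `O(log n)` (`TailAdjust`); and the partial bridge through the transition is the UNIFORM stationary-phase lemma
`Literature.Analysis.Fourier.stationaryPhase_uniform` (eng-4 g6, p471664) applied in `BridgeUniform.liBridgeTail_uniform`.
Sources: Bombieri–Lagarias 1999 Thm 1; Coffey 2005 (122); the PART K/M records; for the Fresnel transition of a stationary point
crossing an endpoint: Erdélyi, *Asymptotic Expansions* (1956) §2.9, Olver (1974) Ch. 3 §13, Wong (1989) Ch. VII (uniform reduction).

FENCES.  (i) RH-equivalent statements (`li_criterion_holds`; the full asymptotics or the sign of `λ_n`) are NOT targets here; the laws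
speak about the zeros of height `> c₁√n` only, through `λ_n = liZeroTail n T + (finite box sum)`, and are consistent with any zero
configuration obeying the known density theorems.  (ii) `LiBridgeFresnelUniform` is a typed family target (pure analysis), not a leaf.
(iii) Successor named in `TARGETS.md` §16: the TAPERED-WINDOW RATE LAW (DATA.md §K, ET4: remainder `∝ n^{−(k+1)/2}` for a `C^k` taper),
which this uniformity makes accessible; not typed here (D-0116: new rungs only on the director's word).
-/

noncomputable section

-- D-0017: `Summit.<S>.<S>.…` is the designed namespace of a single-problem summit.
set_option linter.dupNamespace false

open MeasureTheory
open scoped ArithmeticFunction.vonMangoldt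

namespace Summit.RiemannHypothesis.RiemannHypothesis.Theorems.LiTheory

open Literature.NumberTheory.LFunctions

/-! ## PART N — vocabulary: the Fresnel profile of the resonant prime power -/

/-- The FRESNEL PROFILE of the partial Laguerre bridge at frequency `y`, cut `T`:
`Re{ e^{iF(t₀)} · F''(t₀)^{−1/2} · [fresnelLim − σ(T)·fresnelS(√(2(F(T) − F(t₀))))] }` with `F = Fejer.phF n y` (the exact phase
`y t + n·angS t` of the bridge integrand), `t₀ = Fejer.tz n y = √(n/y − ¼)` its stationary point, `F'' = Fejer.phF2 n`, `σ(T) = 1` if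
`t₀ ≤ T` else `−1`.  `BridgeUniform.liBridgeTail_uniform` reads `|liBridgeTail n y T + liFresnelProfile n y T| ≤ C_y log n` on
`T ∈ [t₀/2, 2t₀]` (the expression below is that theorem's, verbatim).  At `T = t₀` the bracket is `fresnelLim` (half release); for
`T ≪ t₀` it tends to `2·fresnelLim = √π(1+i)·…` (full release: MINUS the profile is the Fejér chirp of `liCoffeyTerm`), for `T ≫ t₀` to `0`. -/
def liFresnelProfile (n : ℕ) (y T : ℝ) : ℝ :=
  (Complex.exp (Complex.I * Fejer.phF n y (Fejer.tz n y)) * ((Real.sqrt (Fejer.phF2 n (Fejer.tz n y)))⁻¹ : ℝ)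
      * (Literature.Analysis.Fourier.fresnelLim - (if Fejer.tz n y ≤ T then (1 : ℂ) else -1)
          * Literature.Analysis.Fourier.fresnelS
              (Real.sqrt (2 * (Fejer.phF n y T - Fejer.phF n y (Fejer.tz n y)))))).re

/-- The same profile in REAL form (the data exhibits' dictionary): `F''(t₀)^{−1/2} √π [(½ − σ(T)·C(X)) cos F(t₀) − (½ − σ(T)·S(X)) sin F(t₀)]`
with `X = √(2(F(T) − F(t₀)))/√π` and the classical `C(x) = ∫_0^x cos(πv²/2)`, `S(x) = ∫_0^x sin(πv²/2)`
(`Literature.NumberTheory.LFunctions.fresnelC/fresnelS`); equal to `liFresnelProfile n y T` by `FresnelLaw.re_main_eq` (the expression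
below is `FresnelLaw.liZeroTail_fresnel_real`'s, verbatim). -/
def liFresnelProfileReal (n : ℕ) (y T : ℝ) : ℝ :=
  (Real.sqrt (Fejer.phF2 n (Fejer.tz n y)))⁻¹ * Real.sqrt Real.pi *
    ((1 / 2 - (if Fejer.tz n y ≤ T then (1 : ℝ) else -1)
        * Literature.NumberTheory.LFunctions.fresnelC
            (Real.sqrt (2 * (Fejer.phF n y T - Fejer.phF n y (Fejer.tz n y))) / Real.sqrt Real.pi))
        * Real.cos (Fejer.phF n y (Fejer.tz n y))
      - (1 / 2 - (if Fejer.tz n y ≤ T then (1 : ℝ) else -1)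
        * Literature.NumberTheory.LFunctions.fresnelS
            (Real.sqrt (2 * (Fejer.phF n y T - Fejer.phF n y (Fejer.tz n y))) / Real.sqrt Real.pi))
        * Real.sin (Fejer.phF n y (Fejer.tz n y)))

/-! ## The rung leaves -/

/-- **RUNG LEAF «UNIFORM TAIL LAW — BRIDGE FORM» (RH-FREE for all `n`; PROOF-OF-DATA; NOT height-buying)** — round 9 of the LI
column.  For `m ≥ 2` and scales `0 < c₁`, `0 < c₂` with `1/c₁² < log(m+1)` and `log(m−1) < 1/c₂²` (the window lies strictly between
the neighbouring resonant scales `c_{m+1} < c₁`, `c₂ < c_{m−1}`) there are `N`, `C` with, for all `n ≥ N` and EVERY cut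
`T ∈ [c₁√n, c₂√n]`:
`|liZeroTail n T − liSmoothTail n T + Σ_{k ∈ Ico 2 m} liCoffeyTerm k n + (Λ(m)/π) m^{−1/2} liBridgeTail n (log m) T| ≤ C log² n`
(`liCoffeyTerm k n = 0` unless `k` is a prime power; for `Λ(m) = 0` the bridge term vanishes and this is the round-7 law on a silent
window).  PROVED in tree, statement-identical: `ZeroTailUniform.liZeroTail_uniform` (rh-li-prover g7).  DATA: eng-6 g4 exhibits 3/3b/4
(kit j259565/j259630/j259690/j259868; see the module docstring).  KILL (pre-registered by eng-6 g4): a cut interval and certified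
`n`-range with band-rms growth exponent of the Fresnel residual `≥ 0.2`, or a normalisation mismatch (`Λ(m)/π`, `m^{−1/2}`, index `n − 1`).
WHAT THIS IS NOT: not evidence for RH, not RH-sensitive, not a positivity statement. [mechanism: PART K contour, uniform in the cut;
statement new] -/
@[conjecture] def LiZeroTailUniform : Prop :=
  ∀ m : ℕ, 2 ≤ m → ∀ c₁ c₂ : ℝ, 0 < c₁ → 0 < c₂ →
    1 / c₁ ^ 2 < Real.log (m + 1 : ℕ) → Real.log (m - 1 : ℕ) < 1 / c₂ ^ 2 →
      ∃ N : ℕ, ∃ C : ℝ, ∀ n : ℕ, N ≤ n → ∀ T : ℝ, c₁ * Real.sqrt n ≤ T → T ≤ c₂ * Real.sqrt n →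
        |liZeroTail n T - liSmoothTail n T + (∑ k ∈ Finset.Ico 2 m, liCoffeyTerm k n)
            + (Λ m : ℝ) / Real.pi * (m : ℝ) ^ (-(1 / 2 : ℝ)) * liBridgeTail n (Real.log m) T|
          ≤ C * Real.log n ^ 2

/-- **RUNG LEAF «UNIFORM TAIL–FRESNEL LAW — PROFILE FORM» (RH-FREE for all `n`; PROOF-OF-DATA; NOT height-buying)** — round 9 of
the LI column (complex normalisation).  Same window as `LiZeroTailUniform` and additionally `log m < 4/c₂²`, i.e. `c₂ < 2c_m`
(`c_m = liResonantScale m`; automatic from `log(m−1) < 1/c₂²` for `m ≥ 3`, for `m = 2` it asks `c₂ < 2c_2 = 2.402…`), so that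
`T ∈ [t₀/2, 2t₀]` for large `n`: there are `N`, `C` with, for all `n ≥ N` and every cut `T ∈ [c₁√n, c₂√n]`,
`|liZeroTail n T − liSmoothTail n T + Σ_{k ∈ Ico 2 m} liCoffeyTerm k n − (Λ(m)/π) m^{−1/2} liFresnelProfile n (log m) T| ≤ C log² n`.
PROVED in tree, statement-identical: `FresnelLaw.liZeroTail_fresnel` (rh-li-prover g7) = `LiZeroTailUniform` ∘ `LiBridgeFresnelUniform`
(the window inclusion `[c₁√n, c₂√n] ⊆ [t₀/2, 2t₀]` for `n ≥ N` is elementary from `t₀ = √(n/log m − ¼)`).  DATA/KILL: as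
`LiZeroTailUniform`.  WHAT THIS IS NOT: not evidence for RH, not RH-sensitive, not a positivity statement. [mechanism: PART K contour +
uniform stationary phase of the partial Laguerre bridge (Fresnel transition); statement new] -/
@[conjecture] def LiZeroTailFresnel : Prop :=
  ∀ m : ℕ, 2 ≤ m → ∀ c₁ c₂ : ℝ, 0 < c₁ → 0 < c₂ →
    1 / c₁ ^ 2 < Real.log (m + 1 : ℕ) → Real.log (m - 1 : ℕ) < 1 / c₂ ^ 2 → Real.log m < 4 / c₂ ^ 2 →
      ∃ N : ℕ, ∃ C : ℝ, ∀ n : ℕ, N ≤ n → ∀ T : ℝ, c₁ * Real.sqrt n ≤ T → T ≤ c₂ * Real.sqrt n →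
        |liZeroTail n T - liSmoothTail n T + (∑ k ∈ Finset.Ico 2 m, liCoffeyTerm k n)
            - (Λ m : ℝ) / Real.pi * (m : ℝ) ^ (-(1 / 2 : ℝ)) * liFresnelProfile n (Real.log m) T|
          ≤ C * Real.log n ^ 2

/-- **«UNIFORM TAIL–FRESNEL LAW — REAL PROFILE»** (RH-FREE; typed companion = the data exhibits' shape): the same law with the
profile written with the classical real Fresnel integrals `C(x) = ∫_0^x cos(πv²/2) dv`, `S(x) = ∫_0^x sin(πv²/2) dv`
(`Literature.NumberTheory.LFunctions.fresnelC/fresnelS`, Anderson–Stark = scipy normalisation) — `liFresnelProfileReal`, eng-6 g4's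
`P_m(n;c)` of exhibit 3 with the exact amplitude `(Λ(m)/π) m^{−1/2} F''(t₀)^{−1/2} √π`.  PROVED in tree, statement-identical:
`FresnelLaw.liZeroTail_fresnel_real` (rh-li-prover g7, `Theorems/LiTailMidpointFresnelLawReal.lean`). -/
@[conjecture] def LiZeroTailFresnelReal : Prop :=
  ∀ m : ℕ, 2 ≤ m → ∀ c₁ c₂ : ℝ, 0 < c₁ → 0 < c₂ →
    1 / c₁ ^ 2 < Real.log (m + 1 : ℕ) → Real.log (m - 1 : ℕ) < 1 / c₂ ^ 2 → Real.log m < 4 / c₂ ^ 2 →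
      ∃ N : ℕ, ∃ C : ℝ, ∀ n : ℕ, N ≤ n → ∀ T : ℝ, c₁ * Real.sqrt n ≤ T → T ≤ c₂ * Real.sqrt n →
        |liZeroTail n T - liSmoothTail n T + (∑ k ∈ Finset.Ico 2 m, liCoffeyTerm k n)
            - (Λ m : ℝ) / Real.pi * (m : ℝ) ^ (-(1 / 2 : ℝ)) * liFresnelProfileReal n (Real.log m) T|
          ≤ C * Real.log n ^ 2

/-! ## Typed family target (pure analysis — NOT a leaf, NOT a route item) and the `_holds` already available -/

/-- **THE PARTIAL LAGUERRE BRIDGE THROUGH THE FRESNEL TRANSITION** (pure analysis; the round-9 core): for every `y > 0` there are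
`N`, `C` with `|liBridgeTail n y T + liFresnelProfile n y T| ≤ C log n` for all `n ≥ N` and every `T ∈ [t₀/2, 2t₀]`, `t₀ = Fejer.tz n y`.
PROVED in tree, statement-identical: `BridgeUniform.liBridgeTail_uniform` (rh-li-eng-4 g6, on `Literature.Analysis.Fourier.
stationaryPhase_uniform`).  Typed here so that the profile form reads `LiZeroTailUniform → LiBridgeFresnelUniform → LiZeroTailFresnel`. -/
@[conjecture] def LiBridgeFresnelUniform : Prop :=
  ∀ y : ℝ, 0 < y →
    ∃ N : ℕ, ∃ C : ℝ, ∀ n : ℕ, N ≤ n → ∀ T : ℝ, Fejer.tz n y / 2 ≤ T → T ≤ 2 * Fejer.tz n y →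
      |liBridgeTail n y T + liFresnelProfile n y T| ≤ C * Real.log n

/-- `LiZeroTailUniform` HOLDS: it is `ZeroTailUniform.liZeroTail_uniform` (rh-li-prover g7), verbatim. -/
theorem liZeroTailUniform_holds : LiZeroTailUniform :=
  fun m hm _c₁ _c₂ hc₁ hc₂ hlow hup ↦ ZeroTailUniform.liZeroTail_uniform m hm hc₁ hc₂ hlow hup

/-- `LiBridgeFresnelUniform` HOLDS: it is `BridgeUniform.liBridgeTail_uniform` (rh-li-eng-4 g6), verbatim. -/
theorem liBridgeFresnelUniform_holds : LiBridgeFresnelUniform :=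
  fun y hy ↦ BridgeUniform.liBridgeTail_uniform y hy

/-- `LiZeroTailFresnel` HOLDS: it is `FresnelLaw.liZeroTail_fresnel` (rh-li-prover g7), verbatim. -/
theorem liZeroTailFresnel_holds : LiZeroTailFresnel :=
  fun m hm _c₁ _c₂ hc₁ hc₂ hlow hup hup' ↦ FresnelLaw.liZeroTail_fresnel m hm hc₁ hc₂ hlow hup hup'

/-- `LiZeroTailFresnelReal` HOLDS: it is `FresnelLaw.liZeroTail_fresnel_real` (rh-li-prover g7), verbatim. -/
theorem liZeroTailFresnelReal_holds : LiZeroTailFresnelReal :=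
  fun m hm _c₁ _c₂ hc₁ hc₂ hlow hup hup' ↦ FresnelLaw.liZeroTail_fresnel_real m hm hc₁ hc₂ hlow hup hup'

end Summit.RiemannHypothesis.RiemannHypothesis.Theorems.LiTheory

end
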